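/-
Copyright (c) 2026 the pub-hodgecm-mathlib formalisation cell (harness21).  Prover seat hodgecm-mathlib-K2E1-p10 (g7), Track B ∕ K2-LIT, h413 =
`stmt-HodgeConjecture-24833`, route `HCCMUnconditional`; R90-TF S8 «ContSpec-n½», (M) socket road, RES-INT line 7 (7d) = the dictionary letter (D3)
«`P′^∞` MEETS `⨆ range Φ_i`» of ★ `oneN_at_of_dictionary` ∕ `oneS_at_of_dictionary` (S8 dealer R90-CS-plan (g4), S8-R290 (1) (w5), 2026-09-05T04:06Z).
-/
import Summits.HodgeConjecture.HodgeConjecture.Theorems.R90S8ResGMidAtomTauU3Defs        -- ★ τ-DEFS (typ2): `IsTauLevel`, `tauLevel`, `resGMidAtomGenτ ∕ resGMidAtomτ ∕ resGMidBlockτ`; brings ★ D1–D3 `resGMidAtomGen ∕ resGMidAtom ∕ resGMidBlock`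
import Literature.NumberTheory.Automorphic.UnitaryIsotypicProjection                     -- ★ `Representation.homRangeSum`, `ContRepresentation.subRep ∕ tauPart`, `IsUnitary.starProjection_closure_homRangeSum_mem_tauPart` (Harish-Chandra)
import Literature.NumberTheory.Automorphic.CompactGroupKFiniteVectorsPeterWeyl           -- ★ Peter–Weyl: `exists_finiteDimensional_invariant_of_t2Space` (every compact Hausdorff group)
import Literature.NumberTheory.Automorphic.UnitaryGroupIwasawaIntegration                -- ★ `isCompact_comap_adelicVal_standardMaximalCompactGL` (`K_max` is compact)
import Literature.NumberTheory.Automorphic.AutomorphicSpectrumProofs                     -- ★ `isStronglyContinuous_rightRegular_holds`; brings ★ `isUnitary_rightRegular`, `DiscreteAutomorphicRep`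
import Literature.NumberTheory.Automorphic.HilbertRepOrthogonalDecomposition             -- ★ `ClosedSubrep.ne_bot_of_isTopIrreducible`
import Literature.NumberTheory.Automorphic.HilbertRepSpectrumProofs                      -- ★ `IsUnitary.toContRep`
import HarnessLib

/-!
# R90 · S8 «ContSpec-n½» — `R90S8ResMidMeetOfDiscreteDecompositionU3`: the (7d) letter «`P′ ∩ Res(V_τ) ≠ 0`» — an irreducible closed `P′ ≤ resGMidBlock ξ μω` contains a
# NON-ZERO vector of the `K`-FINITE residue span — from `hDISC` (admissibility of the middle block at `K_max`) and `hW1`, by Peter–Weyl and Harish-Chandra's «`Cl(V′) ∩ V_fin ⊆ V′`»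
# [HarishChandra1953 Thm. 5; BorelJacquet1979 §4.6; BrockerTomDieck1985 III (5.7); MoeglinWaldspurger1995 V.3.13]

Cell `pub/hodgecm-mathlib`, crux H413 = `stmt-HodgeConjecture-24833` (lane `--kind proof --supports stmt-HodgeConjecture-24833 --as helper`), route of record
`HCCMUnconditional`; programme R90-TF, section S8, the (M) socket road (B ED. 7 :299 `sock_S8_res_middleResidue_isPiN`), RES-INT line 7, letter (D3) of ★ p865166
`oneN_at_of_dictionary` (`hmeet : ∃ x ∈ P, x ≠ 0 ∧ x ∈ ⨆ i, LinearMap.range (Φ i)`).  THEOREMS ONLY (no `def`, no `instance`, no `notation`, no named-fact hypothesis, no `sorry`;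
default heartbeats except `maxHeartbeats 800000` on the two heads, whose statements spell `hDISC`'s bytes — measured).  CLOSES NO SOCKET: it turns (D3) into ★ MODULO two structural letters ON THE DICTIONARY'S RESIDUE SPAN `S` (below), given `hDISC` and `hW1`.

THE MATHEMATICS.  Let `R` be the right regular representation on `L² = L²(U(J₃)(L⁺)∖U(J₃)(𝔸_{L⁺}))` (unitary ★ `isUnitary_rightRegular`, strongly continuous ★
`isStronglyContinuous_rightRegular_holds`), `K_max := adelicVal⁻¹(K_∞·GL₃(𝒪̂_L))` (compact ★ `isCompact_comap_adelicVal_standardMaximalCompactGL`), `B := resGMidBlock ξ μω` (closed,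
`R`-stable), `σ := R|_B|_{K_max}` — EXACTLY the representation `hDISC` (the L1 estate letter, bytes as ★ p863331 ∕ ★ V3 p865313 bind it) speaks about: for every irreducible
finite-dimensional `K_max`-stable `E ≤ B` the `E`-isotypic part `homRangeSum σ (σ|_E)` of `B` is finite-dimensional.  Let `P′ ≤ B` be irreducible closed (so `P′ ≠ ⊥`) and `S ≤ B` a subspace
(the `K`-FINITE RESIDUE SPAN the section dictionary delivers: in the (M) application `S =` the `L²`-image of `⨆ i, range Φ_i`, `Φ_i = Res ∘ T(·, φᵛ_i)` ★ p865340) with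
* (hSfin) every `f ∈ S` lies in a finite-dimensional `R(K_max)`-stable `F ≤ S` («the residue classes of `K`-finite sections are `K_max`-finite INSIDE `S`»: level invariance
  `R(ι_f u) Res φ = Res φ`, `R(k) Res φ = Res (r(k)φ)` — RES-INT equivariance at `K_max`), and
* (hcl) `resGMidBlockτ ξ μω ≤ closure S` («the τ-block is the closure of the `K`-finite residue span» ⟸ `S ⊇` the τ-admissible generators ∧ `closure S` is `R(G(𝔸))`-stable — §3
  `toSubmodule_resGMidBlockτ_le_topologicalClosure_of_invariant`; the (𝔤,K)-module closure statement [BorelJacquet1979 §4.6], [MoeglinWaldspurger1995 I.2.17–I.2.18]).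
Then `P′ ∩ S ∋ f ≠ 0` (§2 HEAD `hmeet_of_discrete_of_hW1`): by `hW1`, `P′ ≤ B ≤ resGMidBlockτ ≤ closure S`; by PETER–WEYL (★ `exists_finiteDimensional_invariant_of_t2Space` + a minimal
stable subspace ★ `exists_minimal_stable_submodule`, irreducible ★ `isIrreducible_subRep_of_minimal`) `P′` contains an irreducible finite-dimensional `K_max`-stable `E ≠ ⊥`, `τ := σ|_E`;
the τ-part `H_τ := homRangeSum σ τ` of `B` is finite-dimensional (`hDISC`), hence CLOSED; the orthogonal projection `q` onto it fixes `E ⊆ H_τ` and maps every finite-dimensional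
stable `F ≤ S` into `F` (HARISH-CHANDRA ★ `IsUnitary.starProjection_closure_homRangeSum_mem_tauPart`: «the `K`-isotypic projectors preserve `V′`»), so `q S ⊆ S ⊓ H_τ`, a
finite-dimensional hence closed subspace; for `0 ≠ w ∈ E`: `w = q w ∈ q (closure S) ⊆ closure (q S) ⊆ S ⊓ H_τ ⊆ S`.  WHY {hDISC, hW1, Peter–Weyl} ALONE DO NOT SUFFICE (census
2026-09-05T04:17Z (3)): `hW1` only puts `P′` inside `resGMidBlockτ = closure span {R(g) r : g ∈ G(𝔸), r τ-admissible}`, and the archimedean translates `R(g_∞) r` are not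
`K_∞`-finite — a closed line inside the closed span of a set need not meet its algebraic span (`ℓ²`: `ℂ·Σₙ eₙ∕n` vs `span {eₙ}`); the two letters (hSfin) (hcl) are exactly what the
`K`-finite argument consumes, both hold for `S = Res(K-finite sections)`, neither is a byte of `hDISC` or `hW1`.
* §1 (ABSTRACT: any compact Hausdorff `K`, any Hilbert space, `σ` unitary strongly continuous) `exists_irreducible_finiteDimensional_le` (Peter–Weyl + minimality),
  **`exists_mem_ne_zero_mem_of_le_closure_of_admissible`** (THE ENGINE: `P` closed stable `≠ ⊥`, `P ≤ closure S`, (hSfin), admissibility on irreducible `K`-types ⇒ `P ∩ S ∋ w ≠ 0`).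
* §2 (the CM frame of (M) ED. 3) `isUnitary_resGMidBlock_restrict_maximalCompact`, `isStronglyContinuous_resGMidBlock_restrict_maximalCompact`, `compactSpace_maximalCompact_three`,
  **`hmeet_of_discrete_of_hW1`** (HEAD, `L²`-side (7d): `∃ f ∈ P'.space, f ≠ 0 ∧ f ∈ S` from `hDISC`, `hW1`, `hP'`, (hSB) (hSfin) (hcl)).
* §3 `toSubmodule_resGMidBlockτ_le_topologicalClosure_of_invariant` ((hcl) ⟸ «τ-generators `⊆ S`» ∧ «`closure S` is `R(G(𝔸))`-stable»), **`hmeet_of_discrete_of_hW1_of_invariant`**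
  (HEAD over those two letters instead of (hcl)).
* §4 (generic bridge to ★ p865166's `X`-currency) **`hmeet_of_exists_mem_space`**: for `Q = {x ∈ X | ↑x ∈ P′}` and `M ≤ X` (`M := ⨆ i, range Φ_i`),
  `(∃ f ∈ P′, f ≠ 0 ∧ f ∈ M.map X.subtype) → ∃ x ∈ Q, x ≠ 0 ∧ x ∈ M` — the `hmeet` binder of ★ `oneN_at_of_dictionary` ∕ `oneS_at_of_dictionary` on the nose.
HONEST LABEL: HC_CM is proved only modulo the 7 printed citations (2 remaining named inputs: hLiu418 = `stmt-HodgeConjecture-24832`, h413 = `stmt-HodgeConjecture-24833`) until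
rung 0 closes; REL ≠ ★ ≠ BUILT; this file asserts no named fact, is conditional by construction on `hDISC`, `hW1` and the two dictionary-side letters (hSfin), (hcl) it names, and
closes no socket ((M) :299 stays `sorry`); count-neutral.

## References
* [HarishChandra1953] Harish-Chandra, *Representations of a semisimple Lie group on a Banach space. I*, Trans. AMS 75 (1953), Thm. 5.
* [BorelJacquet1979] A. Borel, H. Jacquet, *Automorphic forms and automorphic representations*, Proc. Sympos. Pure Math. 33.1 (1979), §4.6.
* [BrockerTomDieck1985] T. Bröcker, T. tom Dieck, *Representations of Compact Lie Groups*, GTM 98 (1985), III (5.6)–(5.7), Thm. (5.10).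
* [WallachRRG1] N. R. Wallach, *Real Reductive Groups I* (1988), §1.4.7, §3.3.1.
* [MoeglinWaldspurger1995] C. Mœglin, J.-L. Waldspurger, *Spectral Decomposition and Eisenstein Series* (1995), I.2.17–I.2.18, II.1, V.3.13.
* [Rogawski1990] J. D. Rogawski, *Automorphic Representations of Unitary Groups in Three Variables*, Ann. of Math. Stud. 123 (1990), §13.9 p. 229 (ii).
-/

set_option autoImplicit false
-- the mandated namespace repeats the single-problem summit's segment (`HodgeConjecture.HodgeConjecture`)
set_option linter.dupNamespace false

noncomputable section

open MeasureTheory Measure Set Filter Topology NumberField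
open Literature.NumberTheory Literature.NumberTheory.Automorphic Literature.NumberTheory.Automorphic.UnitaryGroup Literature.NumberTheory.GaloisRepresentations AdelicGroupData
open Literature.NumberTheory.Automorphic.Arthur2013.Leaves.TECR Literature.NumberTheory.Rogawski1990
open ContRepresentation
open scoped InnerProductSpace

namespace Summit.HodgeConjecture.HodgeConjecture.R90.S8

/-! ## §1 Abstract: Peter–Weyl + Harish-Chandra's «`Cl(V′) ∩ V_fin ⊆ V′`» on an admissible unitary representation of a compact group -/

section Abstract

variable {K : Type*} [Group K] [TopologicalSpace K] [IsTopologicalGroup K] [CompactSpace K] [T2Space K]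
  {H : Type*} [NormedAddCommGroup H] [InnerProductSpace ℂ H] [CompleteSpace H]
  {σ : ContRepresentation ℂ K H}

/-- **PETER–WEYL + MINIMALITY: a non-zero closed stable subspace contains an IRREDUCIBLE finite-dimensional stable `E ≠ ⊥`** (`σ` strongly continuous, `K` compact Hausdorff: ★
`exists_finiteDimensional_invariant_of_t2Space` gives a finite-dimensional stable `V ≠ ⊥` inside, ★ `exists_minimal_stable_submodule` a minimal stable `E ≠ ⊥` inside `V`, irreducible by ★
`isIrreducible_subRep_of_minimal`). [cite: BrockerTomDieck1985, III (5.6)–(5.8)] [cite: WallachRRG1, §1.4.6] -/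
theorem exists_irreducible_finiteDimensional_le (hsc : σ.IsStronglyContinuous)
    (P : Submodule ℂ H) (hPc : IsClosed (P : Set H)) (hPinv : ∀ k, ∀ v ∈ P, σ k v ∈ P) (hP0 : P ≠ ⊥) :
    ∃ (E : Submodule ℂ H) (hE : ∀ k, ∀ v ∈ E, σ k v ∈ E), E ≤ P ∧ E ≠ ⊥ ∧ FiniteDimensional ℂ E ∧ (σ.subRep E hE).IsIrreducible := by
  letI : MeasurableSpace K := borel K
  haveI : BorelSpace K := ⟨rfl⟩
  obtain ⟨V, hVfd, hVP, hV0, hVinv⟩ := exists_finiteDimensional_invariant_of_t2Space σ hsc Measure.haar P hPc hPinv hP0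
  haveI := hVfd
  obtain ⟨E, hEV, hE0, hEK, hEmin⟩ :=
    Literature.NumberTheory.Automorphic.exists_minimal_stable_submodule σ.toRepresentation V hV0 (fun k w hw => hVinv k w hw)
  exact ⟨E, hEK, hEV.trans hVP, hE0, Submodule.finiteDimensional_of_le hEV,
    isIrreducible_subRep_of_minimal hEK hE0 fun U hU hUle => hEmin U hU hUle⟩

/-- **THE ENGINE — a non-zero closed stable subspace of the closure of a `K`-finite span MEETS the span** (Harish-Chandra's «`Cl(V′) ∩ V_fin ⊆ V′`» + Peter–Weyl).  `σ` a unitary strongly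
continuous representation of the compact Hausdorff group `K` on the Hilbert space `H`, ADMISSIBLE ON ITS IRREDUCIBLE `K`-TYPES («for every irreducible finite-dimensional stable `E ≤ H` the
`E`-part `homRangeSum σ (σ|_E)` is finite-dimensional» — the shape of the S8 letter `hDISC`); `S ≤ H` a subspace every vector of which lies in a finite-dimensional stable `F ≤ S` (hSfin);
`P ≤ H` closed, stable, `≠ ⊥`, `P ≤ closure S`.  Then `∃ w ∈ P, w ≠ 0, w ∈ S`.  Proof: §1's irreducible `E ≤ P`, `τ := σ|_E`, `H_τ := homRangeSum σ τ` finite-dimensional hence closed, `q`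
the orthogonal projection onto it; `0 ≠ w ∈ E ⊆ H_τ` so `q w = w`; ★ `IsUnitary.starProjection_closure_homRangeSum_mem_tauPart`: `q F ⊆ tauPart τ F ⊆ F` for finite-dimensional stable
`F`, so `q S ⊆ S ⊓ H_τ` (closed); `w = q w ∈ closure (q S) ⊆ S`. [cite: HarishChandra1953, Thm. 5] [cite: BorelJacquet1979, §4.6] [cite: BrockerTomDieck1985, III Thm (5.7)]
[cite: WallachRRG1, §1.4.7, §3.3.1] -/
theorem exists_mem_ne_zero_mem_of_le_closure_of_admissible (hσ : σ.IsUnitary) (hsc : σ.IsStronglyContinuous)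
    (hadm : ∀ (E : Submodule ℂ H) (hE : ∀ k, ∀ v ∈ E, σ k v ∈ E), FiniteDimensional ℂ E → (σ.subRep E hE).IsIrreducible →
      FiniteDimensional ℂ (Representation.homRangeSum σ.toRepresentation (σ.subRep E hE)))
    (S : Submodule ℂ H) (hSfin : ∀ v ∈ S, ∃ F : Submodule ℂ H, F ≤ S ∧ v ∈ F ∧ FiniteDimensional ℂ F ∧ ∀ k, ∀ x ∈ F, σ k x ∈ F)
    (P : Submodule ℂ H) (hPc : IsClosed (P : Set H)) (hPinv : ∀ k, ∀ v ∈ P, σ k v ∈ P) (hP0 : P ≠ ⊥) (hPS : P ≤ S.topologicalClosure) :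
    ∃ w ∈ P, w ≠ 0 ∧ w ∈ S := by
  -- an irreducible finite-dimensional stable `E ≤ P`, `E ≠ ⊥`
  obtain ⟨E, hEK, hEP, hE0, hEfd, hirr⟩ := exists_irreducible_finiteDimensional_le hsc P hPc hPinv hP0
  haveI := hEfd
  -- its τ-part `Hτ` of `H` is finite-dimensional (admissibility), hence closed
  haveI hfin : FiniteDimensional ℂ (Representation.homRangeSum σ.toRepresentation (σ.subRep E hEK)) := hadm E hEK inferInstance hirr
  set Hτ : Submodule ℂ H := Representation.homRangeSum σ.toRepresentation (σ.subRep E hEK) with hHτ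
  have hHτc : Hτ.topologicalClosure = Hτ := (Submodule.closed_of_finiteDimensional Hτ).submodule_topologicalClosure_eq
  -- a non-zero vector of `E`; it lies in `Hτ` (image of the inclusion `K`-map `σ|_E → σ`)
  obtain ⟨w, hwE, hw0⟩ := Submodule.exists_mem_ne_zero_of_ne_bot hE0
  have hwHτ : w ∈ Hτ := by
    have h := Representation.apply_mem_homRangeSum (σ.subRepSubtype E hEK) (⟨w, hwE⟩ : E)
    rwa [ContRepresentation.subRepSubtype_apply] at h
  -- the orthogonal projection `q` onto `closure Hτ = Hτ`
  set q : H →L[ℂ] H := Hτ.topologicalClosure.starProjection with hq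
  have hqw : q w = w := Submodule.starProjection_eq_self_iff.2 (Hτ.le_topologicalClosure hwHτ)
  -- `q` maps `S` into the finite-dimensional `S ⊓ Hτ`
  have hqS : S.map (q : H →ₗ[ℂ] H) ≤ S ⊓ Hτ := by
    rintro _ ⟨v, hv, rfl⟩
    obtain ⟨F, hFS, hvF, hFfd, hFK⟩ := hSfin v hv
    haveI := hFfd
    refine ⟨hFS (ContRepresentation.tauPart_le hFK (hσ.starProjection_closure_homRangeSum_mem_tauPart (τ := σ.subRep E hEK) hFK hvF)), ?_⟩
    rw [← hHτc]
    exact Hτ.topologicalClosure.starProjection_apply_mem v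
  haveI : FiniteDimensional ℂ ↥(S ⊓ Hτ) := Submodule.finiteDimensional_of_le (inf_le_right : S ⊓ Hτ ≤ Hτ)
  have hSHc : (S ⊓ Hτ).topologicalClosure = S ⊓ Hτ := (Submodule.closed_of_finiteDimensional (S ⊓ Hτ)).submodule_topologicalClosure_eq
  -- `w = q w ∈ closure (q S) ⊆ S ⊓ Hτ`
  have hqw' : q w ∈ (S.map (q : H →ₗ[ℂ] H)).topologicalClosure := Submodule.topologicalClosure_map q S ⟨w, hPS (hEP hwE), rfl⟩
  have hwS : w ∈ S ⊓ Hτ := by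
    rw [← hSHc, ← hqw]
    exact Submodule.topologicalClosure_mono hqS hqw'
  exact ⟨w, hEP hwE, hw0, hwS.1⟩

end Abstract

/-! ## §2 The CM frame of (M) ED. 3: `K_max ↷ resGMidBlock ξ μω`, and the HEAD -/

section CM

variable (L : Type) [Field L] [NumberField L] [IsCMField L]
  (μ : Measure (quasiSplit (↥(maximalRealSubfield L)) L (IsCMField.complexConj L) 3).automorphicQuotient)
  [(quasiSplit (↥(maximalRealSubfield L)) L (IsCMField.complexConj L) 3).IsAutomorphicMeasure μ]
  (ξ : OneDimAutRepH L) (μω : HeckeCharacter L)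

/-- **`K_max = adelicVal⁻¹(K_∞·GL₃(𝒪̂_L)) ≤ U(J₃)(𝔸_{L⁺})` is a compact space** (★ `isCompact_comap_adelicVal_standardMaximalCompactGL`). [cite: BorelJacquet1979, §4.6] -/
theorem compactSpace_maximalCompact_three :
    CompactSpace ↥(((standardMaximalCompactGL 3 L).comap (adelicVal (↥(maximalRealSubfield L)) L (IsCMField.complexConj L) 3 ((StdForm.antidiagonal 3).over L)) :
      Subgroup (quasiSplit (↥(maximalRealSubfield L)) L (IsCMField.complexConj L) 3).Adelic)) :=
  isCompact_iff_compactSpace.1 isCompact_comap_adelicVal_standardMaximalCompactGL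

/-- **`U(J₃)(𝔸_{L⁺})` is Hausdorff** (the datum's carrier is the adelic unitary group ★ `adelic`). [cite: BorelJacquet1979, §4.6] -/
theorem t2Space_quasiSplit_adelic_three : T2Space (quasiSplit (↥(maximalRealSubfield L)) L (IsCMField.complexConj L) 3).Adelic :=
  inferInstanceAs (T2Space (adelic (↥(maximalRealSubfield L)) L (IsCMField.complexConj L) 3 ((StdForm.antidiagonal 3).over L)))

/-- **`R|_{resGMidBlock}|_{K_max}` is unitary** (★ `isUnitary_rightRegular` ∘ ★ `IsUnitary.toContRep`; `restrict` is composition). [cite: BorelJacquet1979, §4.6] -/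
theorem isUnitary_resGMidBlock_restrict_maximalCompact :
    ((resGMidBlock L μ ξ μω).toContRep.restrict
      (((standardMaximalCompactGL 3 L).comap (adelicVal (↥(maximalRealSubfield L)) L (IsCMField.complexConj L) 3 ((StdForm.antidiagonal 3).over L)) :
        Subgroup (quasiSplit (↥(maximalRealSubfield L)) L (IsCMField.complexConj L) 3).Adelic)).subtype).IsUnitary :=
  fun k => ((quasiSplit (↥(maximalRealSubfield L)) L (IsCMField.complexConj L) 3).isUnitary_rightRegular μ).toContRep (resGMidBlock L μ ξ μω)
    (k : (quasiSplit (↥(maximalRealSubfield L)) L (IsCMField.complexConj L) 3).Adelic)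

/-- **`R|_{resGMidBlock}|_{K_max}` is strongly continuous** (★ `isStronglyContinuous_rightRegular_holds` ∘ ★ `isStronglyContinuous_toContRep_of_isStronglyContinuous` ∘ the continuous
inclusion `K_max ↪ G(𝔸)`). [cite: BorelJacquet1979, §4.6] -/
theorem isStronglyContinuous_resGMidBlock_restrict_maximalCompact :
    ((resGMidBlock L μ ξ μω).toContRep.restrict
      (((standardMaximalCompactGL 3 L).comap (adelicVal (↥(maximalRealSubfield L)) L (IsCMField.complexConj L) 3 ((StdForm.antidiagonal 3).over L)) :
        Subgroup (quasiSplit (↥(maximalRealSubfield L)) L (IsCMField.complexConj L) 3).Adelic)).subtype).IsStronglyContinuous := fun v =>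
  ((isStronglyContinuous_toContRep_of_isStronglyContinuous
    ((quasiSplit (↥(maximalRealSubfield L)) L (IsCMField.complexConj L) 3).isStronglyContinuous_rightRegular_holds μ) (resGMidBlock L μ ξ μω)) v).comp
      continuous_subtype_val

set_option maxHeartbeats 800000 in -- measured: the statement spells `hDISC`'s restricted representation four times (★ V3 p865313 :75–:78) and §1 runs on the subtype `↥(resGMidBlock ξ μω)`
/-- **HEAD — (7d) «`P′ ∩ Res(V_τ) ≠ 0`», `L²`-SIDE: `∃ f ∈ P'.space, f ≠ 0 ∧ f ∈ S` FROM `hDISC` AND `hW1`.**  Frame of (M) ED. 3 (★ p865082): `P'` a discrete automorphic representation with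
`P'.space ≤ resGMidBlock ξ μω` (the socket's `hP'`); `hDISC` = the L1 estate letter BYTE FOR BYTE as ★ `res_midBlock_le_residual_of_letters` ∕ ★ V3 `resGMidBlockτ_le_residual_of_record_v3`
bind it (admissibility of `resGMidBlock ξ μω` on its irreducible `K_max`-types); `hW1 : resGMidBlock ξ μω ≤ resGMidBlockτ ξ μω` = the CONCLUSION bytes of ★ p865346
`hW1_of_locallyBoundedContinuation` ∕ ★ p865018 `hW1_of_tauStable`.  `S` = the `K`-finite residue span of the dictionary (in the (M) application the `L²`-image of `⨆ i, range Φ_i`, ★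
p865340), with its two VISIBLE structural letters: (hSfin) every `f ∈ S` lies in a finite-dimensional `R(K_max)`-stable `F ≤ S`; (hcl) `resGMidBlockτ ξ μω ≤ closure S` (§3 derives it from
«τ-generators `⊆ S`» ∧ «`closure S` is `R(G(𝔸))`-stable»); and (hSB) `S ≤ resGMidBlock ξ μω` (residue classes are generators ★ `mem_resGMidBlock_of_mem_gen`).  PROOF = §1's engine on
`H := ↥(resGMidBlock ξ μω)`, `σ := R|_B|_{K_max}` (unitary, strongly continuous, `K_max` compact Hausdorff — this §), `P := P'.space` and `S` pulled back to `B`; `P' ≠ ⊥` by irreducibility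
(★ `ClosedSubrep.ne_bot_of_isTopIrreducible`); `P ≤ closure S` inside `B` from `hP' ∘ hW1 ∘ hcl` and `S ≤ B` (closure in the closed subtype ★ `IsEmbedding.closure_eq_preimage_closure_image`).
[cite: HarishChandra1953, Thm. 5] [cite: BorelJacquet1979, §4.6] [cite: BrockerTomDieck1985, III Thm (5.7)] [cite: MoeglinWaldspurger1995, II.1, V.3.13] [cite: Rogawski1990, §13.9 p. 229 (ii)] -/
theorem hmeet_of_discrete_of_hW1
    -- L1 at the frame (bytes as ★ V3 p865313 binds it)
    (hDISC : ∀ (E : Submodule ℂ (resGMidBlock L μ ξ μω).toSubmodule)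
          (hE : ∀ k, ∀ x ∈ E, ((resGMidBlock L μ ξ μω).toContRep.restrict (((standardMaximalCompactGL 3 L).comap (adelicVal (↥(maximalRealSubfield L)) L (IsCMField.complexConj L) 3 ((StdForm.antidiagonal 3).over L)) : Subgroup (quasiSplit (↥(maximalRealSubfield L)) L (IsCMField.complexConj L) 3).Adelic)).subtype) k x ∈ E), FiniteDimensional ℂ E →
          (((resGMidBlock L μ ξ μω).toContRep.restrict (((standardMaximalCompactGL 3 L).comap (adelicVal (↥(maximalRealSubfield L)) L (IsCMField.complexConj L) 3 ((StdForm.antidiagonal 3).over L)) : Subgroup (quasiSplit (↥(maximalRealSubfield L)) L (IsCMField.complexConj L) 3).Adelic)).subtype).subRep E hE).IsIrreducible →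
          FiniteDimensional ℂ (Representation.homRangeSum ((resGMidBlock L μ ξ μω).toContRep.restrict (((standardMaximalCompactGL 3 L).comap (adelicVal (↥(maximalRealSubfield L)) L (IsCMField.complexConj L) 3 ((StdForm.antidiagonal 3).over L)) : Subgroup (quasiSplit (↥(maximalRealSubfield L)) L (IsCMField.complexConj L) 3).Adelic)).subtype).toRepresentation (((resGMidBlock L μ ξ μω).toContRep.restrict (((standardMaximalCompactGL 3 L).comap (adelicVal (↥(maximalRealSubfield L)) L (IsCMField.complexConj L) 3 ((StdForm.antidiagonal 3).over L)) : Subgroup (quasiSplit (↥(maximalRealSubfield L)) L (IsCMField.complexConj L) 3).Adelic)).subtype).subRep E hE)))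
    -- the τ-admissibility letter `hW1` (conclusion bytes of ★ p865346 ∕ ★ p865018)
    (hW1 : resGMidBlock L μ ξ μω ≤ resGMidBlockτ L μ ξ μω)
    -- the socket's irreducible closed `P′ ≤ resGMidBlock ξ μω`
    (P' : DiscreteAutomorphicRep (quasiSplit (↥(maximalRealSubfield L)) L (IsCMField.complexConj L) 3) μ) (hP' : P'.space ≤ resGMidBlock L μ ξ μω)
    -- the dictionary's residue span and its two structural letters
    (S : Submodule ℂ ((quasiSplit (↥(maximalRealSubfield L)) L (IsCMField.complexConj L) 3).L2 μ)) (hSB : S ≤ (resGMidBlock L μ ξ μω).toSubmodule)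
    (hSfin : ∀ f ∈ S, ∃ F : Submodule ℂ ((quasiSplit (↥(maximalRealSubfield L)) L (IsCMField.complexConj L) 3).L2 μ), F ≤ S ∧ f ∈ F ∧ FiniteDimensional ℂ F ∧
      ∀ k : (quasiSplit (↥(maximalRealSubfield L)) L (IsCMField.complexConj L) 3).Adelic,
        k ∈ (((standardMaximalCompactGL 3 L).comap (adelicVal (↥(maximalRealSubfield L)) L (IsCMField.complexConj L) 3 ((StdForm.antidiagonal 3).over L)) : Subgroup (quasiSplit (↥(maximalRealSubfield L)) L (IsCMField.complexConj L) 3).Adelic)) →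
        ∀ x ∈ F, (quasiSplit (↥(maximalRealSubfield L)) L (IsCMField.complexConj L) 3).rightRegular μ k x ∈ F)
    (hcl : (resGMidBlockτ L μ ξ μω).toSubmodule ≤ S.topologicalClosure) :
    ∃ f ∈ P'.space, f ≠ 0 ∧ f ∈ S := by
  haveI := t2Space_quasiSplit_adelic_three L
  haveI := compactSpace_maximalCompact_three L
  -- the frame: `B := resGMidBlock`, `σ := R|_B|_{K_max}`
  set B := resGMidBlock L μ ξ μω with hB
  set Kmax : Subgroup (quasiSplit (↥(maximalRealSubfield L)) L (IsCMField.complexConj L) 3).Adelic :=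
    ((standardMaximalCompactGL 3 L).comap (adelicVal (↥(maximalRealSubfield L)) L (IsCMField.complexConj L) 3 ((StdForm.antidiagonal 3).over L))) with hKmax
  set σ := B.toContRep.restrict Kmax.subtype with hσdef
  have hσu : σ.IsUnitary := isUnitary_resGMidBlock_restrict_maximalCompact L μ ξ μω
  have hσc : σ.IsStronglyContinuous := isStronglyContinuous_resGMidBlock_restrict_maximalCompact L μ ξ μω
  -- `P := P'.space` and `S` pulled back to `B`
  set PB : Submodule ℂ B.toSubmodule := P'.space.toSubmodule.comap B.toSubmodule.subtype with hPB
  set SB : Submodule ℂ B.toSubmodule := S.comap B.toSubmodule.subtype with hSBdef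
  have hPBc : IsClosed (PB : Set B.toSubmodule) := P'.space.isClosed.preimage continuous_subtype_val
  have hPBinv : ∀ k, ∀ v ∈ PB, σ k v ∈ PB := fun k v hv => P'.space.apply_mem (k : (quasiSplit (↥(maximalRealSubfield L)) L (IsCMField.complexConj L) 3).Adelic) hv
  have hPB0 : PB ≠ ⊥ := by
    have hne : P'.space.toSubmodule ≠ ⊥ := fun h => ClosedSubrep.ne_bot_of_isTopIrreducible P'.irreducible (by
      ext v; rw [← ClosedSubrep.mem_toSubmodule, h, ClosedSubrep.mem_bot, Submodule.mem_bot])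
    obtain ⟨f, hf, hf0⟩ := Submodule.exists_mem_ne_zero_of_ne_bot hne
    intro h
    have hmem : (⟨f, hP' hf⟩ : B.toSubmodule) ∈ PB := hf
    rw [h, Submodule.mem_bot] at hmem
    exact hf0 (congrArg Subtype.val hmem)
  have hSBfin : ∀ v ∈ SB, ∃ F : Submodule ℂ B.toSubmodule, F ≤ SB ∧ v ∈ F ∧ FiniteDimensional ℂ F ∧ ∀ k, ∀ x ∈ F, σ k x ∈ F := by
    intro v hv
    obtain ⟨F, hFS, hvF, hFfd, hFK⟩ := hSfin (v : (quasiSplit (↥(maximalRealSubfield L)) L (IsCMField.complexConj L) 3).L2 μ) hv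
    haveI := hFfd
    refine ⟨F.comap B.toSubmodule.subtype, fun x hx => hFS hx, hvF, ?_, fun k x hx => hFK k k.2 _ hx⟩
    exact Module.Finite.of_injective ((B.toSubmodule.subtype.domRestrict (F.comap B.toSubmodule.subtype)).codRestrict F fun x => x.2)
      fun x y hxy => Subtype.ext (Subtype.ext (congrArg (fun z : F => (z : (quasiSplit (↥(maximalRealSubfield L)) L (IsCMField.complexConj L) 3).L2 μ)) hxy))
  -- `P ≤ closure S` inside `B`: `P'.space ≤ B ≤ resGMidBlockτ ≤ closure S`, `S ⊆ B`, `B` closed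
  have hPS : PB ≤ SB.topologicalClosure := by
    intro v hv
    have hvS : (v : (quasiSplit (↥(maximalRealSubfield L)) L (IsCMField.complexConj L) 3).L2 μ) ∈ S.topologicalClosure :=
      hcl (ClosedSubrep.toSubmodule_le_iff.2 hW1 (hP' hv))
    have hemb : Topology.IsEmbedding (Subtype.val : B.toSubmodule → (quasiSplit (↥(maximalRealSubfield L)) L (IsCMField.complexConj L) 3).L2 μ) := Topology.IsEmbedding.subtypeVal
    have himg : Subtype.val '' (SB : Set B.toSubmodule) = (S : Set ((quasiSplit (↥(maximalRealSubfield L)) L (IsCMField.complexConj L) 3).L2 μ)) := by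
      ext f
      constructor
      · rintro ⟨x, hx, rfl⟩; exact hx
      · intro hf; exact ⟨⟨f, hSB hf⟩, hf, rfl⟩
    change v ∈ closure (SB : Set B.toSubmodule)
    rw [hemb.closure_eq_preimage_closure_image, himg]
    exact hvS
  obtain ⟨w, hwP, hw0, hwS⟩ := exists_mem_ne_zero_mem_of_le_closure_of_admissible hσu hσc hDISC SB hSBfin PB hPBc hPBinv hPB0 hPS
  exact ⟨w, hwP, fun h => hw0 (Subtype.ext h), hwS⟩

/-! ## §3 (hcl) from «τ-generators `⊆ S`» and «`closure S` is `R(G(𝔸))`-stable»; the HEAD over those two letters -/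

/-- **(hcl) ⟸ GENERATORS IN `S` ∧ INVARIANT CLOSURE**: if every τ-admissible generator at every τ-level lies in `S` and `closure S` is `R(G(𝔸))`-stable, then
`resGMidBlockτ ξ μω ≤ closure S` — `closure S` underlies a closed subrepresentation (★ `ClosedSubrep`) containing every τ-atom (closed spans of generators), and the τ-block is the
smallest such (★ `resGMidBlockτ_le`). [cite: MoeglinWaldspurger1995, II.1, V.3.13] [cite: BorelJacquet1979, §4.6] -/
theorem toSubmodule_resGMidBlockτ_le_topologicalClosure_of_invariant
    (S : Submodule ℂ ((quasiSplit (↥(maximalRealSubfield L)) L (IsCMField.complexConj L) 3).L2 μ))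
    (hgen : ∀ U₀ : Subgroup ↥(finAdelic (↥(maximalRealSubfield L)) L (IsCMField.complexConj L) 3 ((StdForm.antidiagonal 3).over L)), IsTauLevel L U₀ →
      resGMidAtomGenτ L μ ξ μω U₀ ⊆ (S : Set ((quasiSplit (↥(maximalRealSubfield L)) L (IsCMField.complexConj L) 3).L2 μ)))
    (hSinv : ∀ (g : (quasiSplit (↥(maximalRealSubfield L)) L (IsCMField.complexConj L) 3).Adelic), ∀ f ∈ S.topologicalClosure,
      (quasiSplit (↥(maximalRealSubfield L)) L (IsCMField.complexConj L) 3).rightRegular μ g f ∈ S.topologicalClosure) :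
    (resGMidBlockτ L μ ξ μω).toSubmodule ≤ S.topologicalClosure := by
  set W : ClosedSubrep ((quasiSplit (↥(maximalRealSubfield L)) L (IsCMField.complexConj L) 3).rightRegular μ) :=
    { toSubmodule := S.topologicalClosure, apply_mem_toSubmodule := fun g f hf => hSinv g f hf, isClosed' := S.isClosed_topologicalClosure } with hW
  have hle : resGMidBlockτ L μ ξ μω ≤ W := resGMidBlockτ_le L μ ξ μω W fun U₀ hU₀ => by
    rw [resGMidAtomτ_def]
    exact Submodule.topologicalClosure_minimal _ ((Submodule.span_le.2 (hgen U₀ hU₀)).trans S.le_topologicalClosure) S.isClosed_topologicalClosure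
  exact ClosedSubrep.toSubmodule_le_iff.2 hle

set_option maxHeartbeats 800000 in -- as the head
/-- **HEAD OVER THE GENERATOR∕INVARIANCE LETTERS — (7d) from `hDISC`, `hW1`, (hSB), (hSfin), «τ-generators `⊆ S`», «`closure S` is `R(G(𝔸))`-stable»** (§2 head ∘ §3).
[cite: HarishChandra1953, Thm. 5] [cite: BorelJacquet1979, §4.6] [cite: MoeglinWaldspurger1995, II.1, V.3.13] [cite: Rogawski1990, §13.9 p. 229 (ii)] -/
theorem hmeet_of_discrete_of_hW1_of_invariant
    (hDISC : ∀ (E : Submodule ℂ (resGMidBlock L μ ξ μω).toSubmodule)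
          (hE : ∀ k, ∀ x ∈ E, ((resGMidBlock L μ ξ μω).toContRep.restrict (((standardMaximalCompactGL 3 L).comap (adelicVal (↥(maximalRealSubfield L)) L (IsCMField.complexConj L) 3 ((StdForm.antidiagonal 3).over L)) : Subgroup (quasiSplit (↥(maximalRealSubfield L)) L (IsCMField.complexConj L) 3).Adelic)).subtype) k x ∈ E), FiniteDimensional ℂ E →
          (((resGMidBlock L μ ξ μω).toContRep.restrict (((standardMaximalCompactGL 3 L).comap (adelicVal (↥(maximalRealSubfield L)) L (IsCMField.complexConj L) 3 ((StdForm.antidiagonal 3).over L)) : Subgroup (quasiSplit (↥(maximalRealSubfield L)) L (IsCMField.complexConj L) 3).Adelic)).subtype).subRep E hE).IsIrreducible →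
          FiniteDimensional ℂ (Representation.homRangeSum ((resGMidBlock L μ ξ μω).toContRep.restrict (((standardMaximalCompactGL 3 L).comap (adelicVal (↥(maximalRealSubfield L)) L (IsCMField.complexConj L) 3 ((StdForm.antidiagonal 3).over L)) : Subgroup (quasiSplit (↥(maximalRealSubfield L)) L (IsCMField.complexConj L) 3).Adelic)).subtype).toRepresentation (((resGMidBlock L μ ξ μω).toContRep.restrict (((standardMaximalCompactGL 3 L).comap (adelicVal (↥(maximalRealSubfield L)) L (IsCMField.complexConj L) 3 ((StdForm.antidiagonal 3).over L)) : Subgroup (quasiSplit (↥(maximalRealSubfield L)) L (IsCMField.complexConj L) 3).Adelic)).subtype).subRep E hE)))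
    (hW1 : resGMidBlock L μ ξ μω ≤ resGMidBlockτ L μ ξ μω)
    (P' : DiscreteAutomorphicRep (quasiSplit (↥(maximalRealSubfield L)) L (IsCMField.complexConj L) 3) μ) (hP' : P'.space ≤ resGMidBlock L μ ξ μω)
    (S : Submodule ℂ ((quasiSplit (↥(maximalRealSubfield L)) L (IsCMField.complexConj L) 3).L2 μ)) (hSB : S ≤ (resGMidBlock L μ ξ μω).toSubmodule)
    (hSfin : ∀ f ∈ S, ∃ F : Submodule ℂ ((quasiSplit (↥(maximalRealSubfield L)) L (IsCMField.complexConj L) 3).L2 μ), F ≤ S ∧ f ∈ F ∧ FiniteDimensional ℂ F ∧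
      ∀ k : (quasiSplit (↥(maximalRealSubfield L)) L (IsCMField.complexConj L) 3).Adelic,
        k ∈ (((standardMaximalCompactGL 3 L).comap (adelicVal (↥(maximalRealSubfield L)) L (IsCMField.complexConj L) 3 ((StdForm.antidiagonal 3).over L)) : Subgroup (quasiSplit (↥(maximalRealSubfield L)) L (IsCMField.complexConj L) 3).Adelic)) →
        ∀ x ∈ F, (quasiSplit (↥(maximalRealSubfield L)) L (IsCMField.complexConj L) 3).rightRegular μ k x ∈ F)
    (hgen : ∀ U₀ : Subgroup ↥(finAdelic (↥(maximalRealSubfield L)) L (IsCMField.complexConj L) 3 ((StdForm.antidiagonal 3).over L)), IsTauLevel L U₀ →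
      resGMidAtomGenτ L μ ξ μω U₀ ⊆ (S : Set ((quasiSplit (↥(maximalRealSubfield L)) L (IsCMField.complexConj L) 3).L2 μ)))
    (hSinv : ∀ (g : (quasiSplit (↥(maximalRealSubfield L)) L (IsCMField.complexConj L) 3).Adelic), ∀ f ∈ S.topologicalClosure,
      (quasiSplit (↥(maximalRealSubfield L)) L (IsCMField.complexConj L) 3).rightRegular μ g f ∈ S.topologicalClosure) :
    ∃ f ∈ P'.space, f ≠ 0 ∧ f ∈ S :=
  hmeet_of_discrete_of_hW1 L μ ξ μω hDISC hW1 P' hP' S hSB hSfin (toSubmodule_resGMidBlockτ_le_topologicalClosure_of_invariant L μ ξ μω S hgen hSinv)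

end CM

/-! ## §4 Generic bridge to the `X`-currency of ★ `oneN_at_of_dictionary` ∕ `oneS_at_of_dictionary` -/

section Bridge

variable {V : Type*} [AddCommGroup V] [Module ℂ V]

/-- **THE `hmeet` BINDER OF ★ p865166 FROM THE `L²`-SIDE (7d).**  `X ≤ V` a subspace (the smooth vectors of `L²`), `Q` a subspace of `↥X` cut out by `P′` («`x ∈ Q ↔ ↑x ∈ P′`», (D1)'s
`P := P′^∞`), `M ≤ ↥X` (`⨆ i, range Φ_i`): if `P′` contains a non-zero vector of the `V`-image of `M`, then `Q` contains a non-zero vector of `M` — `∃ x ∈ Q, x ≠ 0 ∧ x ∈ M`, the shape of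
`hmeet`. [cite: BorelJacquet1979, §4.6] -/
theorem hmeet_of_exists_mem_space (X : Submodule ℂ V) (P : Submodule ℂ V) (Q : Submodule ℂ ↥X) (hQ : ∀ x : ↥X, x ∈ Q ↔ (x : V) ∈ P)
    (M : Submodule ℂ ↥X) (h : ∃ f ∈ P, f ≠ 0 ∧ f ∈ M.map X.subtype) :
    ∃ x ∈ Q, x ≠ 0 ∧ x ∈ M := by
  obtain ⟨f, hfP, hf0, x, hxM, rfl⟩ := h
  exact ⟨x, (hQ x).2 hfP, fun hx => hf0 (by rw [hx]; rfl), hxM⟩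

/-- The same with `M := ⨆ i, range Φ_i` spelled for a family of linear maps into `↥X` (the `Φ i` of (D2), read as linear maps). [cite: BorelJacquet1979, §4.6] -/
theorem hmeet_of_exists_mem_space_iSup {ι : Type*} {E : Type*} [AddCommGroup E] [Module ℂ E]
    (X : Submodule ℂ V) (P : Submodule ℂ V) (Q : Submodule ℂ ↥X) (hQ : ∀ x : ↥X, x ∈ Q ↔ (x : V) ∈ P) (Φ : ι → E →ₗ[ℂ] ↥X)
    (h : ∃ f ∈ P, f ≠ 0 ∧ f ∈ (⨆ i, LinearMap.range (Φ i)).map X.subtype) :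
    ∃ x ∈ Q, x ≠ 0 ∧ x ∈ ⨆ i, LinearMap.range (Φ i) :=
  hmeet_of_exists_mem_space X P Q hQ _ h

end Bridge

end Summit.HodgeConjecture.HodgeConjecture.R90.S8

end
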